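import Summits.Schanuel.Schanuel.Theorems.DiophantineDichotomyApproximationPropertyOrbitClusterBound
import Summits.Schanuel.Schanuel.Theorems.DiophantineDichotomyApproximationPropertyOrbitClusterBoundDeficientLemmas
import Summits.Schanuel.Schanuel.Theorems.DiophantineDichotomyApproximationPropertyOrbitClusterBoundDeficientNorm

/-!
# The deficient-rank lever of line `orbit-interpolation-determinant` (crux `ApproximationProperty`, stmt-Schanuel-6117)

Registered stub `orbitClusterBoundDeficient_of` (KERNEL-c8 §4 / KERNEL-c6 R1), PROVED: from the
number-field kit (Galois hull with lifts of complex embeddings, equal fibres of the restriction of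
embeddings, norm of an extended ideal) and the convexity step (Jensen for `k ↦ c₀ k^p − k`) one gets
the statement `OrbitClusterBoundDeficient` of `…DeficientLeverDefs`: for `t ≥ 1` (`c₀ = 1/4`,
`C = 2t + 2`), a number field `K` (`D = [K:ℚ]`), `β ∈ Kᵗ`, `r ≥ 1` exponent vectors `αⱼ` of total
degree `≤ δ` with `ℚ`-linearly independent monomials `β^{αⱼ}`, and `k` distinct complex embeddings
putting `σᵢ(β)` in the sup-ball of radius `rad ≤ 1` about `x`,
`(¼ (kr/D)^{1+1/t} − kr/D) log(1/rad) ≤ C (δ (r/D) h_K(1:β) + r log(D+1) + (kr/D) δ log(2+‖x‖) + (kr/D) log(δ+2))`.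

## Proof (Galois-averaged interpolation determinant on a maximal minor)

Scale by `n ∈ ℕ` (`nβ` integral), `x̲ = (n, nβ)`, `𝔞 = (x̲)`, `yⱼ = n^δ β^{αⱼ} ∈ J = 𝔞^δ`. Pick `r`
complex embeddings `S₀ a` with `det (S₀ a (yⱼ)) ≠ 0` (`exists_embeddings_det_ne_zero`), lift them to
`φ_a : K → L` into a hull `L` (kit), and form the INTEGRAL minor `M = det(φ_a(yⱼ)) ∈ 𝓞_L`, `M ≠ 0`.
LOWER bound (`pow_absNorm_le_prod_norm_det`): `N(J)^{e r} ≤ ∏_τ |τ M|`, `e = [L:K]`. UPPER bound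
for each conjugate minor `τ M = det((τ∘φ_a)(yⱼ))` (`norm_det_minor_le`, `k_τ` = number of rows
`τ∘φ_a` among the `σᵢ`): `|τM| ≤ (δ+1)^{t k_τ} rad^{⌈¼k_τ^{1+1/t} − k_τ⌉} r! (2+‖x‖)^{2δk_τ} (∏ₐ max|τφ_a x̲|)^δ`.
Taking logarithms and summing over `τ`: `∑_τ ∑_a log max|τφ_a x̲| = r e ∑_ρ log max|ρ x̲| = r e log(N(𝔞) H_K(1:β))`
(`sum_sum_comp_eq`, `absNorm_mul_mulHeight_eq_prod_embeddings`), so `N(𝔞)^{δ e r}` CANCELS;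
`∑_τ k_τ = r k e` (`sum_card_cluster_eq`) and Jensen give `[L:ℚ](¼ k̄^p − k̄) ≤ ∑_τ (¼ k_τ^p − k_τ)`
with `k̄ = kr/D`; divide by `[L:ℚ] = eD` and use `r! ≤ (D+1)^r` (`r ≤ D`). -/

open Finset Matrix NumberField Module Height

-- `Summit.Schanuel.Schanuel.…` is the mandated summit/sub-problem namespace (single-conjunct summit):
set_option linter.dupNamespace false

namespace Summit.Schanuel.Schanuel.Cruxes.ApproximationProperty.OrbitInterpolationDeterminant

/-- **The deficient-rank lever** (registered stub `orbitClusterBoundDeficient_of` of line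
`orbit-interpolation-determinant`): the number-field kit and the Jensen step imply
`OrbitClusterBoundDeficient` (with `c₀ = 1/4`, `C = 2t + 2`). -/
theorem orbitClusterBoundDeficient_of : ((∀ (K : Type) [Field K] [NumberField K], ∃ (L : Type) (_ : Field L) (_ : NumberField L) (ι : L →+* ℂ) (lift : (K →+* ℂ) → (K →+* L)), ∀ σ : K →+* ℂ, ι.comp (lift σ) = σ) ∧ (∀ (K L : Type) [Field K] [NumberField K] [Field L] [NumberField L] (φ : K →+* L) (ρ : K →+* ℂ), Module.finrank ℚ K ∣ Module.finrank ℚ L ∧ Nat.card {τ : L →+* ℂ // τ.comp φ = ρ} = Module.finrank ℚ L / Module.finrank ℚ K) ∧ (∀ (K L : Type) [Field K] [NumberField K] [Field L] [NumberField L] (φ : K →+* L) (𝔞 : Ideal (NumberField.RingOfIntegers K)), Ideal.absNorm (𝔞.map (NumberField.RingOfIntegers.mapRingHom φ)) = Ideal.absNorm 𝔞 ^ (Module.finrank ℚ L / Module.finrank ℚ K))) → (∀ (p c₀ : ℝ), 1 ≤ p → 0 ≤ c₀ → ∀ (ι : Type) (s : Finset ι) (f : ι → ℝ) (a : ℝ),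 s.Nonempty → (∀ i ∈ s, 0 ≤ f i) → ∑ i ∈ s, f i = s.card * a → (s.card : ℝ) * (c₀ * a ^ p - a) ≤ ∑ i ∈ s, (c₀ * f i ^ p - f i)) → ∀ t : ℕ, 1 ≤ t → ∃ c₀ : ℝ, 0 < c₀ ∧ ∃ C : ℝ, 0 < C ∧ ∀ (K : Type) [Field K] [NumberField K] (β : Fin t → K) (δ k r : ℕ) (α : Fin r → Fin t → ℕ) (σ : Fin k → (K →+* ℂ)) (x : Fin t → ℂ) (rad : ℝ), 1 ≤ r → (∀ j, ∑ l, α j l ≤ δ) → LinearIndependent ℚ (fun j => ∏ l, β l ^ α j l) → Function.Injective σ → 0 < rad → rad ≤ 1 → (∀ i, ‖(fun j => σ i (β j)) - x‖ ≤ rad) → (c₀ * ((k : ℝ) * r / Module.finrank ℚ K) ^ (1 + 1 / (t : ℝ)) - (k : ℝ) * r / Module.finrank ℚ K) * Real.log (1 / rad) ≤ C * (δ * ((r : ℝ) / Module.finrank ℚ K) * Height.logHeight (Fin.cons (1 : K) β : Fin (t + 1) → K) + r * Real.log (Module.finrank ℚ K + 1) + (k : ℝ) * r / Module.finrank ℚ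 K * δ * Real.log (2 + ‖x‖) + (k : ℝ) * r / Module.finrank ℚ K * Real.log ((δ : ℝ) + 2)) := by
  intro hkit hJ t ht
  refine ⟨1 / 4, by norm_num, 2 * t + 2, by positivity, ?_⟩
  intro K _ _ β δ k r α σ x rad hr hαdeg hαli hσ hr0 hr1 hclose
  classical
  have hD0 : 0 < finrank ℚ K := finrank_pos
  -- § integer scaling and the integral tuple `xI = (n, nβ₁, …, nβ_t)`
  obtain ⟨n, hn0, hnint⟩ := exists_nat_mul_isIntegral β
  have hnK : ((n : K)) ≠ 0 := by exact_mod_cast hn0.ne'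
  have hnR : (0 : ℝ) < n := by exact_mod_cast hn0
  have hnI : IsIntegral ℤ ((n : K)) := by
    simpa using (isIntegral_algebraMap (R := ℤ) (A := K) (x := (n : ℤ)))
  let xI : Fin (t + 1) → 𝓞 K :=
    Fin.cons ⟨(n : K), (mem_integralClosure_iff ℤ K).mpr hnI⟩
      (fun l => ⟨(n : K) * β l, (mem_integralClosure_iff ℤ K).mpr (hnint l)⟩)
  have hxI0 : ((xI 0 : 𝓞 K) : K) = n := by simp [xI]
  have hxIs : ∀ l : Fin t, ((xI l.succ : 𝓞 K) : K) = n * β l := by intro l; simp [xI]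
  have hxI_ne : xI ≠ 0 := by
    intro h
    have h0 := congrFun h 0
    have : ((xI 0 : 𝓞 K) : K) = 0 := by rw [h0]; rfl
    rw [hxI0] at this
    exact hnK this
  set 𝔞 : Ideal (𝓞 K) := Ideal.span (Set.range xI)
  have h𝔞0 : 𝔞 ≠ ⊥ := by
    intro h
    have hmem : xI 0 ∈ 𝔞 := Ideal.subset_span ⟨0, rfl⟩
    rw [h, Ideal.mem_bot] at hmem
    have : ((xI 0 : 𝓞 K) : K) = 0 := by rw [hmem]; rfl
    rw [hxI0] at this
    exact hnK this
  -- the tuple in `K`, the scaled monomials `y j = n^δ β^{α j}` and their integral avatars `yO j ∈ 𝔞^δ`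
  let xK : Fin (t + 1) → K := fun i => ((xI i : 𝓞 K) : K)
  have hxK0 : xK 0 = n := hxI0
  have hxKs : ∀ l : Fin t, xK l.succ = n * β l := hxIs
  let y : Fin r → K := fun j => (n : K) ^ δ * ∏ l, β l ^ α j l
  have hy : ∀ j, y j = (n : K) ^ δ * ∏ l, β l ^ α j l := fun j => rfl
  let yO : Fin r → 𝓞 K := fun j => xI 0 ^ (δ - ∑ l, α j l) * ∏ l, xI l.succ ^ α j l
  have hyOJ : ∀ j, yO j ∈ 𝔞 ^ δ := by
    intro j
    have h1 : xI 0 ^ (δ - ∑ l, α j l) ∈ 𝔞 ^ (δ - ∑ l, α j l) :=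
      Ideal.pow_mem_pow (Ideal.subset_span (Set.mem_range_self (f := xI) 0) : xI 0 ∈ 𝔞) _
    have h2 : ∏ l, xI l.succ ^ α j l ∈ 𝔞 ^ (∑ l, α j l) := by
      rw [← Finset.prod_pow_eq_pow_sum]
      exact Ideal.prod_mem_prod fun l _ => Ideal.pow_mem_pow
        (Ideal.subset_span (Set.mem_range_self (f := xI) l.succ) : xI l.succ ∈ 𝔞) _
    have h3 := Ideal.mul_mem_mul h1 h2
    rwa [← pow_add, Nat.sub_add_cancel (hαdeg j)] at h3
  have hyOK : ∀ j, ((yO j : 𝓞 K) : K) = y j := by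
    intro j
    change algebraMap (𝓞 K) K (xI 0 ^ (δ - ∑ l, α j l) * ∏ l, xI l.succ ^ α j l) =
      (n : K) ^ δ * ∏ l, β l ^ α j l
    simp only [map_mul, map_pow, map_prod]
    have e0 : algebraMap (𝓞 K) K (xI 0) = n := hxI0
    have es : ∀ l, algebraMap (𝓞 K) K (xI l.succ) = n * β l := hxIs
    rw [e0]
    simp_rw [es, mul_pow, Finset.prod_mul_distrib, Finset.prod_pow_eq_pow_sum]
    rw [← mul_assoc, ← pow_add, Nat.sub_add_cancel (hαdeg j)]
  have hliy : LinearIndependent ℚ y := by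
    have hq : ((n : ℚ)) ^ δ ≠ 0 := pow_ne_zero _ (by exact_mod_cast hn0.ne')
    have h := hαli.units_smul (fun _ => Units.mk0 (((n : ℚ)) ^ δ) hq)
    convert h using 1
    funext j
    simp only [Pi.smul_apply', Units.smul_mk0, y, Algebra.smul_def, map_pow, map_natCast]
  have hrD : r ≤ finrank ℚ K := by simpa using hliy.fintype_card_le_finrank
  -- § rows: a non-singular maximal minor of the embedding matrix of `y`
  obtain ⟨S₀, -, hdet0⟩ := exists_embeddings_det_ne_zero y hliy
  -- § the Galois hull `L`, the lifts `φ a` of the rows, the fibre size `e = [L:K]`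
  obtain ⟨L, _, _, ιL, lft, hlft⟩ := hkit.1 K
  let φ : Fin r → (K →+* L) := fun a => lft (S₀ a)
  have hιφ : ∀ a, ιL.comp (φ a) = S₀ a := fun a => hlft (S₀ a)
  set D : ℕ := finrank ℚ K
  set e : ℕ := finrank ℚ L / D
  have hdvd : D ∣ finrank ℚ L := (hkit.2.1 K L (φ ⟨0, hr⟩) (S₀ ⟨0, hr⟩)).1
  have hfib : ∀ a (ρ : K →+* ℂ), Nat.card {τ : L →+* ℂ // τ.comp (φ a) = ρ} = e :=
    fun a ρ => (hkit.2.1 K L (φ a) ρ).2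
  have hJnorm : ∀ a, Ideal.absNorm ((𝔞 ^ δ).map (RingOfIntegers.mapRingHom (φ a))) =
      Ideal.absNorm (𝔞 ^ δ) ^ e := fun a => hkit.2.2 K L (φ a) (𝔞 ^ δ)
  have hNL : finrank ℚ L = e * D := (Nat.div_mul_cancel hdvd).symm
  have hNLcast : (finrank ℚ L : ℝ) = (e : ℝ) * D := by exact_mod_cast hNL
  have hNLpos : (0 : ℝ) < finrank ℚ L := by exact_mod_cast (finrank_pos : 0 < finrank ℚ L)
  have hDne : (D : ℝ) ≠ 0 := by exact_mod_cast hD0.ne'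
  have hcardL : (Finset.univ : Finset (L →+* ℂ)).card = finrank ℚ L := by
    rw [Finset.card_univ, NumberField.Embeddings.card L ℂ]
  set p : ℝ := 1 + 1 / (t : ℝ) with hp
  have hp1 : 1 ≤ p := by
    rw [hp]
    have : (0 : ℝ) ≤ 1 / (t : ℝ) := by positivity
    linarith
  set kbar : ℝ := (k : ℝ) * r / D with hkbar
  have hkbar0 : 0 ≤ kbar := by rw [hkbar]; positivity
  -- § the integral minor `det (φ a (yO j))` is non-singular
  have hdetτ : ∀ τ : L →+* ℂ,
      τ (((Matrix.of fun a j => RingOfIntegers.mapRingHom (φ a) (yO j)).det : 𝓞 L) : L) =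
        (Matrix.of fun a j => (τ.comp (φ a)) (y j)).det := by
    intro τ
    rw [map_det_mapRingHom φ yO τ]
    congr 1
    ext a j
    simp only [Matrix.of_apply, hyOK]
  have hMO : (Matrix.of fun a j => RingOfIntegers.mapRingHom (φ a) (yO j)).det ≠ 0 := by
    intro h0
    apply hdet0
    have h1 := hdetτ ιL
    rw [h0] at h1
    have h2 : (Matrix.of fun a j => (ιL.comp (φ a)) (y j)) = Matrix.of fun a j => S₀ a (y j) := by
      ext a j
      simp only [Matrix.of_apply, hιφ]
    rw [h2] at h1
    rw [← h1]
    simp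
  -- § LOWER bound through the norm to `ℚ`
  have hNpos : 0 < (Ideal.absNorm 𝔞 : ℝ) := by
    have : Ideal.absNorm 𝔞 ≠ 0 := by
      rw [Ne, Ideal.absNorm_eq_zero_iff]; exact h𝔞0
    positivity
  have hNJ : (Ideal.absNorm (𝔞 ^ δ) : ℝ) = (Ideal.absNorm 𝔞 : ℝ) ^ δ := by
    rw [map_pow, Nat.cast_pow]
  let dτ : (L →+* ℂ) → ℝ := fun τ => ‖(Matrix.of fun a j => (τ.comp (φ a)) (y j)).det‖
  have hlow : (((Ideal.absNorm 𝔞 : ℝ) ^ δ) ^ e) ^ r ≤ ∏ τ : L →+* ℂ, dτ τ := by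
    have h := pow_absNorm_le_prod_norm_det φ (𝔞 ^ δ) e hJnorm yO hyOJ hMO
    rw [hNJ] at h
    refine h.trans_eq (Finset.prod_congr rfl fun τ _ => ?_)
    rw [hdetτ τ]
  have hdpos : ∀ τ, 0 < dτ τ := by
    have hprod : 0 < ∏ τ : L →+* ℂ, dτ τ :=
      lt_of_lt_of_le (pow_pos (pow_pos (pow_pos hNpos δ) e) r) hlow
    intro τ
    rcases (norm_nonneg _ : 0 ≤ dτ τ).lt_or_eq with hlt | heq
    · exact hlt
    · exfalso
      rw [Finset.prod_eq_zero (Finset.mem_univ τ) heq.symm] at hprod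
      exact lt_irrefl _ hprod
  -- § UPPER bound for each conjugate minor (cluster bound on the rows `τ ∘ φ a ∈ {σ i}`)
  let Rv : (K →+* ℂ) → ℝ := fun ρ => ⨆ i : Fin (t + 1), ‖ρ (xK i)‖
  have hRv_pos : ∀ ρ : K →+* ℂ, 0 < Rv ρ := fun ρ => by
    have h : ‖ρ (xK 0)‖ ≤ Rv ρ :=
      le_ciSup (Finite.bddAbove_range fun i : Fin (t + 1) => ‖ρ (xK i)‖) 0
    rw [hxK0, map_natCast, Complex.norm_natCast] at h
    exact hnR.trans_le h
  let Sτ : (L →+* ℂ) → Finset (Fin r) := fun τ =>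
    Finset.univ.filter (fun a => τ.comp (φ a) ∈ Set.range σ)
  have hSτ : ∀ τ : L →+* ℂ, ∀ a ∈ Sτ τ, ‖(fun l => (τ.comp (φ a)) (β l)) - x‖ ≤ rad := by
    intro τ a ha
    obtain ⟨i, hi⟩ := (Finset.mem_filter.mp ha).2
    rw [← hi]
    exact hclose i
  set G : ℝ := ((δ : ℝ) + 1) ^ t with hGdef
  set c2 : ℝ := ((2 + ‖x‖) ^ 2) ^ δ with hc2
  let mm : (L →+* ℂ) → ℕ := fun τ => ⌈(1 / 4 : ℝ) * ((Sτ τ).card : ℝ) ^ p - (Sτ τ).card⌉₊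
  have hup : ∀ τ : L →+* ℂ, dτ τ ≤ G ^ (Sτ τ).card * rad ^ (mm τ) * (r.factorial : ℝ) *
      c2 ^ (Sτ τ).card * (∏ a, Rv (τ.comp (φ a))) ^ δ :=
    fun τ => norm_det_minor_le ht β δ α hαdeg n hn0 y hy xK hxK0 hxKs (fun a => τ.comp (φ a)) x rad
      hr0 hr1 (Sτ τ) (hSτ τ)
  -- § logarithms
  have hG1 : 1 ≤ G := one_le_pow₀ (by linarith [(Nat.cast_nonneg δ : (0 : ℝ) ≤ δ)])
  have hc21 : 1 ≤ c2 := one_le_pow₀ (by nlinarith [norm_nonneg x])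
  have hGpos : 0 < G := one_pos.trans_le hG1
  have hc2pos : 0 < c2 := one_pos.trans_le hc21
  have hfpos : (0 : ℝ) < r.factorial := by exact_mod_cast r.factorial_pos
  have hlogU : ∀ τ : L →+* ℂ, Real.log (G ^ (Sτ τ).card * rad ^ (mm τ) * (r.factorial : ℝ) *
      c2 ^ (Sτ τ).card * (∏ a, Rv (τ.comp (φ a))) ^ δ) =
        ((Sτ τ).card : ℝ) * Real.log G + (mm τ : ℝ) * Real.log rad + Real.log (r.factorial : ℝ) +
          ((Sτ τ).card : ℝ) * Real.log c2 + (δ : ℝ) * ∑ a, Real.log (Rv (τ.comp (φ a))) := by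
    intro τ
    have h1 : G ^ (Sτ τ).card ≠ 0 := (pow_pos hGpos _).ne'
    have h2 : rad ^ (mm τ) ≠ 0 := (pow_pos hr0 _).ne'
    have h3 : (r.factorial : ℝ) ≠ 0 := hfpos.ne'
    have h4 : c2 ^ (Sτ τ).card ≠ 0 := (pow_pos hc2pos _).ne'
    have h5 : (∏ a, Rv (τ.comp (φ a))) ^ δ ≠ 0 :=
      (pow_pos (Finset.prod_pos fun a _ => hRv_pos _) δ).ne'
    rw [Real.log_mul (mul_ne_zero (mul_ne_zero (mul_ne_zero h1 h2) h3) h4) h5,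
      Real.log_mul (mul_ne_zero (mul_ne_zero h1 h2) h3) h4,
      Real.log_mul (mul_ne_zero h1 h2) h3, Real.log_mul h1 h2,
      Real.log_pow G (Sτ τ).card, Real.log_pow rad (mm τ), Real.log_pow c2 (Sτ τ).card,
      Real.log_pow (∏ a, Rv (τ.comp (φ a))) δ, Real.log_prod (fun a _ => (hRv_pos _).ne')]
  -- the cluster counts sum to `r k e`
  have hsK : ∑ τ : L →+* ℂ, ((Sτ τ).card : ℝ) = r * k * e := by
    have h := sum_card_cluster_eq φ e hfib σ hσ Sτ (fun τ a => by simp [Sτ])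
    exact_mod_cast h
  -- the archimedean product `∏_ρ maxᵢ |ρ x̲ᵢ| = N(𝔞) · H_K(1 : β)`
  set H : ℝ := mulHeight (Fin.cons (1 : K) β : Fin (t + 1) → K) with hHdef
  have hH1 : 1 ≤ H := one_le_mulHeight _
  have hxK_smul : (fun i => ((xI i : 𝓞 K) : K)) = (n : K) • (Fin.cons (1 : K) β : Fin (t + 1) → K) := by
    funext i
    refine Fin.cases ?_ (fun l => ?_) i
    · rw [hxI0]; simp
    · rw [hxIs l]; simp
  have hNA : (Ideal.absNorm 𝔞 : ℝ) * H = ∏ ρ : K →+* ℂ, Rv ρ := by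
    rw [hHdef, ← mulHeight_smul_eq_mulHeight _ hnK, ← hxK_smul]
    exact absNorm_mul_mulHeight_eq_prod_embeddings xI hxI_ne
  have hsR : ∑ ρ : K →+* ℂ, Real.log (Rv ρ) = Real.log (Ideal.absNorm 𝔞 : ℝ) + Real.log H := by
    rw [← Real.log_prod (fun ρ _ => (hRv_pos ρ).ne'), ← hNA,
      Real.log_mul hNpos.ne' (one_pos.trans_le hH1).ne']
  have hcomp : ∑ τ : L →+* ℂ, ∑ a, Real.log (Rv (τ.comp (φ a))) =
      r * e * ∑ ρ : K →+* ℂ, Real.log (Rv ρ) :=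
    sum_sum_comp_eq φ e hfib (fun ρ => Real.log (Rv ρ))
  -- § the logarithmic inequality, summed over `τ`
  have hsum1 : ∑ τ : L →+* ℂ, Real.log (dτ τ) ≤ ∑ τ : L →+* ℂ,
      (((Sτ τ).card : ℝ) * Real.log G + (mm τ : ℝ) * Real.log rad + Real.log (r.factorial : ℝ) +
        ((Sτ τ).card : ℝ) * Real.log c2 + (δ : ℝ) * ∑ a, Real.log (Rv (τ.comp (φ a)))) :=
    Finset.sum_le_sum fun τ _ => (Real.log_le_log (hdpos τ) (hup τ)).trans_eq (hlogU τ)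
  have hmain : (r : ℝ) * ((e : ℝ) * ((δ : ℝ) * Real.log (Ideal.absNorm 𝔞 : ℝ))) ≤
      (∑ τ : L →+* ℂ, ((Sτ τ).card : ℝ)) * Real.log G +
        (∑ τ : L →+* ℂ, (mm τ : ℝ)) * Real.log rad +
        (finrank ℚ L : ℝ) * Real.log (r.factorial : ℝ) +
        (∑ τ : L →+* ℂ, ((Sτ τ).card : ℝ)) * Real.log c2 +
        (δ : ℝ) * ∑ τ : L →+* ℂ, ∑ a, Real.log (Rv (τ.comp (φ a))) := by
    have h1 := Real.log_le_log (pow_pos (pow_pos (pow_pos hNpos δ) e) r) hlow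
    rw [Real.log_pow, Real.log_pow, Real.log_pow, Real.log_prod (fun τ _ => (hdpos τ).ne')] at h1
    refine (h1.trans hsum1).trans_eq ?_
    rw [Finset.sum_add_distrib, Finset.sum_add_distrib, Finset.sum_add_distrib,
      Finset.sum_add_distrib, Finset.sum_mul, Finset.sum_mul, Finset.sum_mul, Finset.mul_sum,
      Finset.sum_const, hcardL, nsmul_eq_mul]
  rw [hsK, hcomp, hsR] at hmain
  -- § ceilings, Jensen, and division by `[L:ℚ]`
  have hlr0 : Real.log rad ≤ 0 := Real.log_nonpos hr0.le hr1
  have hmm : ∀ τ : L →+* ℂ, (mm τ : ℝ) * Real.log rad ≤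
      (1 / 4 * ((Sτ τ).card : ℝ) ^ p - (Sτ τ).card) * Real.log rad :=
    fun τ => mul_le_mul_of_nonpos_right (Nat.le_ceil _) hlr0
  have hsumM : (∑ τ : L →+* ℂ, (mm τ : ℝ)) * Real.log rad ≤
      (∑ τ : L →+* ℂ, (1 / 4 * ((Sτ τ).card : ℝ) ^ p - (Sτ τ).card)) * Real.log rad := by
    rw [Finset.sum_mul, Finset.sum_mul]
    exact Finset.sum_le_sum fun τ _ => hmm τ
  have hekr : (finrank ℚ L : ℝ) * kbar = r * k * e := by
    rw [hNLcast, hkbar, ← mul_div_assoc, div_eq_iff hDne]; ring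
  have her : (finrank ℚ L : ℝ) * (r / D) = r * e := by
    rw [hNLcast, ← mul_div_assoc, div_eq_iff hDne]; ring
  have hJen : (finrank ℚ L : ℝ) * (1 / 4 * kbar ^ p - kbar) ≤
      ∑ τ : L →+* ℂ, (1 / 4 * ((Sτ τ).card : ℝ) ^ p - (Sτ τ).card) := by
    have h := hJ p (1 / 4) hp1 (by norm_num) (L →+* ℂ) Finset.univ (fun τ => ((Sτ τ).card : ℝ))
      kbar Finset.univ_nonempty (fun τ _ => Nat.cast_nonneg _)
      (by rw [hsK, hcardL]; exact hekr.symm)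
    rw [hcardL] at h
    exact h
  have hpen : (∑ τ : L →+* ℂ, (1 / 4 * ((Sτ τ).card : ℝ) ^ p - (Sτ τ).card)) * -Real.log rad ≤
      (r : ℝ) * k * e * (Real.log G + Real.log c2) + (finrank ℚ L : ℝ) * Real.log (r.factorial : ℝ) +
        δ * (r * e) * Real.log H := by
    linarith [hmain, hsumM]
  have hJenM : (finrank ℚ L : ℝ) * (1 / 4 * kbar ^ p - kbar) * -Real.log rad ≤
      (∑ τ : L →+* ℂ, (1 / 4 * ((Sτ τ).card : ℝ) ^ p - (Sτ τ).card)) * -Real.log rad :=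
    mul_le_mul_of_nonneg_right hJen (by linarith)
  have hR : (r : ℝ) * k * e * (Real.log G + Real.log c2) +
      (finrank ℚ L : ℝ) * Real.log (r.factorial : ℝ) + δ * (r * e) * Real.log H =
        (finrank ℚ L : ℝ) * (kbar * (Real.log G + Real.log c2) + Real.log (r.factorial : ℝ) +
          δ * (r / D) * Real.log H) := by
    linear_combination (-(Real.log G + Real.log c2)) * hekr + (-((δ : ℝ) * Real.log H)) * her
  have hkey : (finrank ℚ L : ℝ) * ((1 / 4 * kbar ^ p - kbar) * -Real.log rad) ≤
      (finrank ℚ L : ℝ) * (kbar * (Real.log G + Real.log c2) + Real.log (r.factorial : ℝ) +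
        δ * (r / D) * Real.log H) := by
    have h := hJenM.trans hpen
    rw [hR] at h
    linarith [h]
  have hfin := le_of_mul_le_mul_left hkey hNLpos
  have hLG : Real.log G = t * Real.log ((δ : ℝ) + 1) := by rw [hGdef, Real.log_pow]
  have hLc : Real.log c2 = δ * (2 * Real.log (2 + ‖x‖)) := by
    rw [hc2, Real.log_pow, Real.log_pow]; push_cast; ring
  have hΛ : -Real.log rad = Real.log (1 / rad) := by rw [one_div, Real.log_inv]
  rw [hLG, hLc, hΛ] at hfin
  -- § final bookkeeping
  have hfact : Real.log (r.factorial : ℝ) ≤ r * Real.log ((D : ℝ) + 1) := by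
    have hrD' : (r : ℝ) ≤ D := by exact_mod_cast hrD
    have h1 : (r.factorial : ℝ) ≤ ((D : ℝ) + 1) ^ r := by
      calc (r.factorial : ℝ) ≤ ((r ^ r : ℕ) : ℝ) := by exact_mod_cast Nat.factorial_le_pow r
        _ = (r : ℝ) ^ r := by push_cast; ring
        _ ≤ ((D : ℝ) + 1) ^ r := pow_le_pow_left₀ (by positivity) (by linarith) _
    calc Real.log (r.factorial : ℝ) ≤ Real.log (((D : ℝ) + 1) ^ r) :=
          Real.log_le_log hfpos h1
      _ = r * Real.log ((D : ℝ) + 1) := by rw [Real.log_pow]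
  have hL1 : 0 ≤ Real.log ((δ : ℝ) + 1) :=
    Real.log_nonneg (by linarith [(Nat.cast_nonneg δ : (0 : ℝ) ≤ δ)])
  have hL12 : Real.log ((δ : ℝ) + 1) ≤ Real.log ((δ : ℝ) + 2) :=
    Real.log_le_log (by positivity) (by linarith)
  have hL2 : 0 ≤ Real.log (2 + ‖x‖) := Real.log_nonneg (by linarith [norm_nonneg x])
  have hLH : 0 ≤ Real.log H := Real.log_nonneg hH1
  have hLD : 0 ≤ Real.log ((D : ℝ) + 1) :=
    Real.log_nonneg (by linarith [(Nat.cast_nonneg D : (0 : ℝ) ≤ D)])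
  have hδ0 : (0 : ℝ) ≤ δ := Nat.cast_nonneg δ
  have hrR : (0 : ℝ) ≤ r := Nat.cast_nonneg r
  have ht0 : (0 : ℝ) ≤ t := Nat.cast_nonneg t
  have hT1 : (t : ℝ) * Real.log ((δ : ℝ) + 1) ≤ (2 * t + 2) * Real.log ((δ : ℝ) + 2) := by
    have h1 := mul_nonneg (by positivity : (0 : ℝ) ≤ 2 * t + 2) (sub_nonneg.mpr hL12)
    have h2 := mul_nonneg (by positivity : (0 : ℝ) ≤ t + 2) hL1
    linarith
  have hT1k : kbar * ((t : ℝ) * Real.log ((δ : ℝ) + 1)) ≤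
      kbar * ((2 * t + 2) * Real.log ((δ : ℝ) + 2)) :=
    mul_le_mul_of_nonneg_left hT1 hkbar0
  have hT2 : (r : ℝ) * Real.log ((D : ℝ) + 1) ≤ (2 * t + 2) * (r * Real.log ((D : ℝ) + 1)) := by
    have h0 : 0 ≤ (r : ℝ) * Real.log ((D : ℝ) + 1) := mul_nonneg hrR hLD
    have h1 := mul_nonneg (by positivity : (0 : ℝ) ≤ 2 * t + 1) h0
    linarith
  have hT3 : kbar * ((δ : ℝ) * (2 * Real.log (2 + ‖x‖))) ≤
      (2 * t + 2) * (kbar * δ * Real.log (2 + ‖x‖)) := by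
    have h0 : 0 ≤ kbar * δ * Real.log (2 + ‖x‖) := mul_nonneg (mul_nonneg hkbar0 hδ0) hL2
    have h1 := mul_nonneg ht0 h0
    linarith
  have hT4 : (δ : ℝ) * (r / D) * Real.log H ≤ (2 * t + 2) * (δ * (r / D) * Real.log H) := by
    have h0 : 0 ≤ (δ : ℝ) * (r / D) * Real.log H :=
      mul_nonneg (mul_nonneg hδ0 (by positivity)) hLH
    have h1 := mul_nonneg (by positivity : (0 : ℝ) ≤ 2 * t + 1) h0
    linarith
  have hkT : kbar * ((2 * t + 2) * Real.log ((δ : ℝ) + 2)) =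
      (2 * t + 2) * (kbar * Real.log ((δ : ℝ) + 2)) := by ring
  have hLHeq : Real.log H = logHeight (Fin.cons (1 : K) β : Fin (t + 1) → K) := rfl
  rw [← hLHeq]
  linarith [hfin, hT1k, hT2, hT3, hT4, hkT, hfact]

end Summit.Schanuel.Schanuel.Cruxes.ApproximationProperty.OrbitInterpolationDeterminant
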